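import Summits.HodgeConjecture.CorCM.Zeta7PrimitiveWeilFamiliesDivisorial
import HarnessLib

/-!
# COR-CM: constant-sum families of CM types of `ℚ(ζ₇)` with ALL eight types — the three multiplicity relations,
# and `d(S) = d(S̄)` for all `S` iff the two `ℚ(√-7)`-induced types occur equally often

Cell `pub-hodgecm2` (COR-CM = stage 2 of the Hodge ladder), seat b27 (gen 23), count-neutral; part 3a of the `ℚ(ζ₇)`
lane (part 1 `CorCM/Zeta7PrimitiveResidueTypes`: the CM types of `ℚ(ζ₇)` by residue sets; part 2
`CorCM/Zeta7PrimitiveWeilFamiliesDivisorial`: for PRIMITIVE types / SIMPLE factors every constant-sum family is a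
union of conjugate pairs; part 3b `CorCM/Zeta7WeilFamiliesExceptionalCriterion`: the geometric consequences).  NEW as
stated (not a published statement), hence under `Summits/`; everything PROVED (finite facts `decide`d on `ℤ/7`, then
`omega`); the only definitions are explicit finite data (`res8`, `conj8`) and the multiplicity
`resCount Ψ R = #{j | resSet Ψ_j = R}` (Deligne's `d(Φ_R)`); no named fact, no `sorry`.

THE SOURCE CONSTRUCTION.  P. Deligne, *Hodge cycles on abelian varieties*, LNM 900 (1982), **I §5 (c)** (re-edition
pp. 38–39): for a family `(Φ_j)_{j<d}` of CM types of a CM field `E` with `Σ_j Φ_j = constant` the lines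
`H^d(⊕_j A_{Φ_j})_{Δ×{s}}` of `⋀^d_E H¹(⊕_j A_{Φ_j}, ℚ)(d/2)` are (absolute) Hodge classes — the WEIL CLASSES — and by
**Lemma 5.2** (p. 40) a family that is a union of conjugate pairs `{Φ, Φ̄}` (multiplicities `d(Φ) = d(Φ̄)`)
contributes only products of divisor classes; the tree's dictionary `Deligne1982/WeilClassesCMFamilyDivisorCriterion`
shows that this is exactly when the Weil lines lie in `Dᵐ ⊗ ℂ` (`weightClassesAlg_weilWeight_le_divisorClassesSpan_iff`).

THE QUESTION ANSWERED HERE.  `K = ℚ(ζ₇)` has EIGHT CM types: the six PRIMITIVE ones `P₀, …, P₅` (residue sets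
`prim7 i`, the translates of `{1,2,3}`; realised by SIMPLE CM threefolds) and the two IMPRIMITIVE ones
`Q = {1,2,4}`, `Q̄ = {3,5,6}` induced from `ℚ(√-7)` (realised by `E³` with the two conjugate `𝓞_K`-structures, `E` an
elliptic curve with CM by `ℚ(√-7)`; part 1).  Which constant-sum families `Ψ : Fin (2m) → CMType ℚ(ζ₇)` — with
imprimitive members ALLOWED — are unions of conjugate pairs?

* §1 `colsum_relations` — the `6 × 8` incidence matrix "unit `c ∈ res8 k`" has the three row relations
  `R₁ − R₃`, `R₂ − R₃`, `R₁ − R₅`; constant incidence sums of a multiplicity vector `n : Fin 8 → ℕ` force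
  **`n(P₅) + n(Q̄) = n(P₀) + n(Q)`, `n(P₄) + n(Q̄) = n(P₁) + n(Q)`, `n(P₂) + n(Q̄) = n(P₃) + n(Q)`** (the system has rank
  `3`; rows `R₄`, `R₆` are then automatic), so `n` is conjugation-symmetric iff `n(Q) = n(Q̄)`
  (`colsum_symmetric_iff`) — part 1's `primitive_colsum_symmetric` is the face `n(Q) = n(Q̄) = 0`;
* §2 **`resCount_relations`** — the same three relations for the multiplicities `d(Φ_R) = resCount Ψ R` of every
  constant-sum family `Ψ` (`sum_resCount_res8_eq`: the column sums are incidence sums); **`typeCount_symmetric_iff`** —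
  `d(S) = d(S̄)` for every set `S` of embeddings **iff** `resCount Ψ {1,2,4} = resCount Ψ {3,5,6}`.

So over `ℚ(ζ₇)` "union of conjugate pairs" is decided by ONE integer, `#Q − #Q̄`; part 3b turns this into the
exceptionality criterion for Deligne's Weil classes on products of CM threefolds with CM by `ℚ(ζ₇)`.

## References

* [Deligne1982HodgeCycles] P. Deligne, *Hodge cycles on abelian varieties*, LNM 900 (1982), I §5 (c), Lemma 5.2
  (re-edition pp. 38–40).
* [Shimura1998] G. Shimura, *Abelian Varieties with Complex Multiplication and Modular Functions* (1998), §8.2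
  Prop. 26, §6.2 Thm. 3.
* [Washington1997] L. C. Washington, *Introduction to Cyclotomic Fields*, Thm. 2.5.
-/

noncomputable section

open CategoryTheory CategoryTheory.Limits NumberField

namespace Summit.HodgeConjecture.CorCM.Zeta7WeilFamily

open Literature.NumberTheory.ComplexMultiplication
open Literature.AlgebraicGeometry.Motives (AbelianVariety CMType)
open Literature.AlgebraicGeometry.HodgeTheory
open Literature.AlgebraicGeometry.Pohlmann1968
open Literature.AlgebraicGeometry.Pohlmann1968.Cyclotomic
open Literature.AlgebraicGeometry.Deligne1982

/-! ### §1 The eight CM residue sets of `(ℤ/7)ˣ` and the three relations of the `6 × 8` incidence matrix -/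

section Residues

/-- **The eight CM residue sets of `(ℤ/7)ˣ`** (sets of representatives of `(ℤ/7)ˣ/{±1}`): the six primitive
`P₀, …, P₅ = prim7 0, …, prim7 5` (translates of `{1,2,3}`) followed by the two imprimitive ones `Q = {1,2,4}` (index
`6`) and `Q̄ = {3,5,6}` (index `7`), the cosets of the squares — the types induced from `ℚ(√-7)`.
[cite: Shimura1998, §8.2 Prop. 26] -/
def res8 : Fin 8 → Finset (ZMod 7) :=
  ![{1, 2, 3}, {2, 4, 6}, {2, 3, 6}, {1, 4, 5}, {1, 3, 5}, {4, 5, 6}, {1, 2, 4}, {3, 5, 6}]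

/-- Conjugation on the indices of `res8`: `k ↦ 5 − k` on the primitive block (as `conj6`), `6 ↔ 7`. [folklore] -/
def conj8 : Fin 8 → Fin 8 := ![5, 4, 3, 2, 1, 0, 7, 6]

/-- The values of `res8`, as literals. [folklore] -/
theorem res8_values : res8 0 = {1, 2, 3} ∧ res8 1 = {2, 4, 6} ∧ res8 2 = {2, 3, 6} ∧ res8 3 = {1, 4, 5} ∧
    res8 4 = {1, 3, 5} ∧ res8 5 = {4, 5, 6} ∧ res8 6 = {1, 2, 4} ∧ res8 7 = {3, 5, 6} :=
  ⟨rfl, rfl, rfl, rfl, rfl, rfl, rfl, rfl⟩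

/-- The primitive block of `res8` is `prim7`. [cite: Shimura1998, §8.2 Prop. 26] -/
theorem res8_castLE (i : Fin 6) : res8 (Fin.castLE (by omega) i) = prim7 i := by
  fin_cases i <;> rfl

/-- `res8` is injective (the eight sets are distinct). [folklore] -/
theorem res8_injective : Function.Injective res8 := by decide

/-- `conj8` is an involution. [folklore] -/
theorem conj8_conj8 : ∀ k : Fin 8, conj8 (conj8 k) = k := by decide

/-- **Conjugate pairs**: `res8 (conj8 k) = −res8 k = {c | −c ∈ res8 k}` on the units (`P₀ ↔ P₅`, `P₁ ↔ P₄`,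
`P₂ ↔ P₃`, `Q ↔ Q̄`). [folklore] -/
theorem res8_conj8 : ∀ k : Fin 8, res8 (conj8 k) = units7.filter fun c => -c ∈ res8 k := by decide

set_option maxRecDepth 8192 in
set_option synthInstance.maxSize 2048 in
set_option synthInstance.maxHeartbeats 200000 in
/-- **Every CM residue set of `(ℤ/7)ˣ` is one of the eight `res8 k`** (a set `S` of units with `c ∈ S ↔ −c ∉ S`;
decided over the `2⁶` subsets). [cite: Shimura1998, §8.2 Prop. 26] [cite: Washington1997, Thm. 2.5] -/
theorem exists_res8_eq : ∀ S ∈ units7.powerset, (∀ c ∈ units7, (c ∈ S ↔ -c ∉ S)) → ∃ k : Fin 8, res8 k = S := by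
  decide

/-- **The three relations of the `6 × 8` incidence matrix.**  If `n : Fin 8 → ℕ` (multiplicities of the eight types
in a family) has CONSTANT incidence sums `Σ_{k : c ∈ res8 k} n k` over the units `c` (Deligne's `Σ_j Ψ_j = constant`),
then `n 5 + n 7 = n 0 + n 6`, `n 4 + n 7 = n 1 + n 6`, `n 2 + n 7 = n 3 + n 6` — from the rows `c = 1, 2, 3, 5`:
`(R₁) n0+n3+n4+n6`, `(R₂) n0+n1+n2+n6`, `(R₃) n0+n2+n4+n7`, `(R₅) n3+n4+n5+n7`.  Equivalently
`n(P̄ᵢ) − n(Pᵢ) = n(Q) − n(Q̄)` for the three conjugate pairs of primitive types: the asymmetry of the primitive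
multiplicities is dictated by that of the two `ℚ(√-7)`-induced ones. [cite: Deligne1982HodgeCycles, I §5 (c) and Lemma 5.2 (pp. 38–40)] -/
theorem colsum_relations (n : Fin 8 → ℕ)
    (h : ∀ c ∈ units7, ∀ c' ∈ units7,
      ∑ k ∈ Finset.univ.filter (fun k => c ∈ res8 k), n k = ∑ k ∈ Finset.univ.filter (fun k => c' ∈ res8 k), n k) :
    n 5 + n 7 = n 0 + n 6 ∧ n 4 + n 7 = n 1 + n 6 ∧ n 2 + n 7 = n 3 + n 6 := by
  have e1 : (Finset.univ.filter fun k : Fin 8 => (1 : ZMod 7) ∈ res8 k) = {0, 3, 4, 6} := by decide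
  have e2 : (Finset.univ.filter fun k : Fin 8 => (2 : ZMod 7) ∈ res8 k) = {0, 1, 2, 6} := by decide
  have e3 : (Finset.univ.filter fun k : Fin 8 => (3 : ZMod 7) ∈ res8 k) = {0, 2, 4, 7} := by decide
  have e5 : (Finset.univ.filter fun k : Fin 8 => (5 : ZMod 7) ∈ res8 k) = {3, 4, 5, 7} := by decide
  have s4 : ∀ a b c d : Fin 8, a ≠ b → a ≠ c → a ≠ d → b ≠ c → b ≠ d → c ≠ d →
      ∑ i ∈ ({a, b, c, d} : Finset (Fin 8)), n i = n a + n b + n c + n d := by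
    intro a b c d hab hac had hbc hbd hcd
    rw [Finset.sum_insert (by simp [hab, hac, had]), Finset.sum_insert (by simp [hbc, hbd]), Finset.sum_pair hcd]
    ring
  have h13 := h 1 (by decide) 3 (by decide)
  rw [e1, e3, s4 0 3 4 6 (by decide) (by decide) (by decide) (by decide) (by decide) (by decide),
    s4 0 2 4 7 (by decide) (by decide) (by decide) (by decide) (by decide) (by decide)] at h13
  have h23 := h 2 (by decide) 3 (by decide)
  rw [e2, e3, s4 0 1 2 6 (by decide) (by decide) (by decide) (by decide) (by decide) (by decide),
    s4 0 2 4 7 (by decide) (by decide) (by decide) (by decide) (by decide) (by decide)] at h23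
  have h15 := h 1 (by decide) 5 (by decide)
  rw [e1, e5, s4 0 3 4 6 (by decide) (by decide) (by decide) (by decide) (by decide) (by decide),
    s4 3 4 5 7 (by decide) (by decide) (by decide) (by decide) (by decide) (by decide)] at h15
  omega

/-- **Conjugation symmetry is decided by the two imprimitive multiplicities**: under constant incidence sums,
`n (conj8 k) = n k` for all `k` iff `n 6 = n 7` (`#Q = #Q̄`).  Part 1's `primitive_colsum_symmetric` is the case
`n 6 = n 7 = 0`. [cite: Deligne1982HodgeCycles, I §5 (c) and Lemma 5.2 (pp. 38–40)] -/
theorem colsum_symmetric_iff (n : Fin 8 → ℕ)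
    (h : ∀ c ∈ units7, ∀ c' ∈ units7,
      ∑ k ∈ Finset.univ.filter (fun k => c ∈ res8 k), n k = ∑ k ∈ Finset.univ.filter (fun k => c' ∈ res8 k), n k) :
    (∀ k, n (conj8 k) = n k) ↔ n 6 = n 7 := by
  obtain ⟨h05, h14, h23⟩ := colsum_relations n h
  have hc : conj8 0 = 5 ∧ conj8 1 = 4 ∧ conj8 2 = 3 ∧ conj8 3 = 2 ∧ conj8 4 = 1 ∧ conj8 5 = 0 ∧
      conj8 6 = 7 ∧ conj8 7 = 6 := by decide
  obtain ⟨c0, c1, c2, c3, c4, c5, c6, c7⟩ := hc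
  constructor
  · intro hk
    have h := hk 7
    rw [c7] at h
    exact h
  · intro h67 k
    have h0 : n (conj8 0) = n 0 := by rw [c0]; omega
    have h1 : n (conj8 1) = n 1 := by rw [c1]; omega
    have h2 : n (conj8 2) = n 2 := by rw [c2]; omega
    have h3 : n (conj8 3) = n 3 := by rw [c3]; omega
    have h4 : n (conj8 4) = n 4 := by rw [c4]; omega
    have h5 : n (conj8 5) = n 5 := by rw [c5]; omega
    have h6 : n (conj8 6) = n 6 := by rw [c6]; omega
    have h7 : n (conj8 7) = n 7 := by rw [c7]; omega
    fin_cases k <;> assumption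

end Residues

/-! ### §2 Multiplicities by residue set of a constant-sum family over `ℚ(ζ₇)`; symmetry iff `#Q = #Q̄` -/

section Family

variable {L : Type} [Field L] [NumberField L] [IsCyclotomicExtension {7} ℚ L] {m : ℕ}

/-- **Deligne's multiplicity `d(Φ_R)` of the CM type with residue set `R`** in the family `Ψ = (Ψ_j)_{j<2m}`: the number
of slots `j` with `resSet Ψ_j = R` (for `R = resSet Ψ_{j₀}` this is `typeCount Ψ Ψ_{j₀}`,
`typeCount_self_eq_resCount`). [cite: Deligne1982HodgeCycles, I §5 (p. 39)] -/
def resCount (Ψ : Fin (2 * m) → CMType L) (R : Finset (ZMod 7)) : ℕ := {j : Fin (2 * m) | resSet L (Ψ j) = R}.ncard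

/-- Every CM type of `ℚ(ζ₇)` has residue set `res8 k` for some `k < 8`. [cite: Shimura1998, §8.2 Prop. 26]
[cite: Washington1997, Thm. 2.5] -/
theorem exists_res8_eq_resSet (Φ : CMType L) : ∃ k : Fin 8, res8 k = resSet L Φ :=
  exists_res8_eq _ (Finset.mem_powerset.2 (resSet_subset L Φ)) (resSet_cm L Φ)

/-- `d(Ψ_{j₀}) = resCount Ψ (resSet Ψ_{j₀})`: equality of types is read on residue sets.
[cite: Deligne1982HodgeCycles, I §5 (p. 39)] [cite: Washington1997, Thm. 2.5] -/
theorem typeCount_self_eq_resCount (Ψ : Fin (2 * m) → CMType L) (j₀ : Fin (2 * m)) :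
    typeCount Ψ (Ψ j₀).1 = resCount Ψ (resSet L (Ψ j₀)) := by
  unfold typeCount resCount
  congr 1
  ext j
  exact carrier_eq_iff_resSet_eq L (Ψ j) (Ψ j₀)

/-- `d(Ψ̄_{j₀}) = resCount Ψ (−resSet Ψ_{j₀})`: conjugacy of types is read on residue sets.
[cite: Deligne1982HodgeCycles, I §5 (p. 39)] [cite: Washington1997, Thm. 2.5] -/
theorem typeCount_compl_eq_resCount (Ψ : Fin (2 * m) → CMType L) (j₀ : Fin (2 * m)) :
    typeCount Ψ ((Ψ j₀).1)ᶜ = resCount Ψ (units7.filter fun c => -c ∈ resSet L (Ψ j₀)) := by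
  unfold typeCount resCount
  congr 1
  ext j
  exact carrier_eq_compl_iff_resSet_eq L (Ψ j) (Ψ j₀)

omit [NumberField L] [IsCyclotomicExtension {7} ℚ L] in
/-- A set of embeddings that is not a member of the family has multiplicity `0`. [cite: Deligne1982HodgeCycles, I §5 (p. 39)] -/
theorem typeCount_eq_zero_of_forall_ne (Ψ : Fin (2 * m) → CMType L) {S : Set (L →+* ℂ)} (h : ∀ j, (Ψ j).1 ≠ S) :
    typeCount Ψ S = 0 := by
  have he : {j : Fin (2 * m) | (Ψ j).1 = S} = ∅ := Set.eq_empty_iff_forall_notMem.2 fun j hj => h j hj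
  rw [typeCount, he, Set.ncard_empty]

/-- A residue set that is not attained has multiplicity `0`. [cite: Deligne1982HodgeCycles, I §5 (p. 39)] -/
theorem resCount_eq_zero_of_forall_ne (Ψ : Fin (2 * m) → CMType L) {R : Finset (ZMod 7)}
    (h : ∀ j, resSet L (Ψ j) ≠ R) : resCount Ψ R = 0 := by
  have he : {j : Fin (2 * m) | resSet L (Ψ j) = R} = ∅ := Set.eq_empty_iff_forall_notMem.2 fun j hj => h j hj
  rw [resCount, he, Set.ncard_empty]

/-- An attained residue set has positive multiplicity. [cite: Deligne1982HodgeCycles, I §5 (p. 39)] -/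
theorem resCount_pos_of_eq (Ψ : Fin (2 * m) → CMType L) {R : Finset (ZMod 7)} {j₀ : Fin (2 * m)}
    (h : resSet L (Ψ j₀) = R) : 0 < resCount Ψ R :=
  (Set.ncard_pos (Set.toFinite _)).2 ⟨j₀, h⟩

/-- **Column sums as incidence sums of the multiplicities**: for a constant-sum family (`#{j | t ∈ Ψ_j} = m` for every
embedding `t`) and every unit `c`, `Σ_{k : c ∈ res8 k} resCount Ψ (res8 k) = m` (the embedding `σ_c` lies in `Ψ_j` iff
`c ∈ resSet Ψ_j`, and the slots are partitioned by their residue sets). [cite: Deligne1982HodgeCycles, I §5 (c) (pp. 38–39)] -/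
theorem sum_resCount_res8_eq (Ψ : Fin (2 * m) → CMType L)
    (hsum : ∀ t : L →+* ℂ, {j : Fin (2 * m) | t ∈ (Ψ j).1}.ncard = m) {c : ZMod 7} (hc : c ∈ units7) :
    ∑ k ∈ Finset.univ.filter (fun k => c ∈ res8 k), resCount Ψ (res8 k) = m := by
  classical
  choose idx hidx using fun j => exists_res8_eq_resSet (L := L) (Ψ j)
  obtain ⟨σ, rfl⟩ := exists_expOf_eq 7 L c ((coprime_seven_iff_mem_units7 c).2 hc)
  have h1 : (Finset.univ.filter fun j : Fin (2 * m) => expOf 7 L σ ∈ res8 (idx j)).card = m := by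
    have hset' : {j : Fin (2 * m) | σ ∈ (Ψ j).1} = {j | expOf 7 L σ ∈ res8 (idx j)} := by
      ext j
      simp only [Set.mem_setOf_eq, hidx, mem_resSet_iff]
    have h := hsum σ
    rw [hset', ncard_setOf_fin_eq_card_filter] at h
    exact h
  rw [Finset.card_eq_sum_card_fiberwise (f := idx)
    (s := Finset.univ.filter fun j : Fin (2 * m) => expOf 7 L σ ∈ res8 (idx j))
    (t := Finset.univ.filter fun k : Fin 8 => expOf 7 L σ ∈ res8 k)
    (fun j hj => Finset.mem_filter.2
      ⟨Finset.mem_univ _, (Finset.mem_filter.1 (Finset.mem_coe.1 hj)).2⟩)] at h1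
  refine Eq.trans (Finset.sum_congr rfl fun k hk => ?_) h1
  have hk' : expOf 7 L σ ∈ res8 k := (Finset.mem_filter.1 hk).2
  rw [resCount, ncard_setOf_fin_eq_card_filter]
  congr 1
  ext j
  simp only [Finset.mem_filter, Finset.mem_univ, true_and]
  rw [← hidx j, res8_injective.eq_iff]
  exact ⟨fun h => ⟨by rw [h]; exact hk', h⟩, fun h => h.2⟩

/-- **The three relations for a constant-sum family over `ℚ(ζ₇)`** (all eight types allowed):
`d(P₅) + d(Q̄) = d(P₀) + d(Q)`, `d(P₄) + d(Q̄) = d(P₁) + d(Q)`, `d(P₂) + d(Q̄) = d(P₃) + d(Q)` with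
`P₀, …, P₅ = {1,2,3}, {2,4,6}, {2,3,6}, {1,4,5}, {1,3,5}, {4,5,6}`, `Q = {1,2,4}`, `Q̄ = {3,5,6}` — for each conjugate
pair of primitive types, `d(P̄) − d(P) = d(Q) − d(Q̄)`. [cite: Deligne1982HodgeCycles, I §5 (c) and Lemma 5.2 (pp. 38–40)]
[cite: Shimura1998, §8.2 Prop. 26] -/
theorem resCount_relations (Ψ : Fin (2 * m) → CMType L)
    (hsum : ∀ t : L →+* ℂ, {j : Fin (2 * m) | t ∈ (Ψ j).1}.ncard = m) :
    resCount Ψ {4, 5, 6} + resCount Ψ {3, 5, 6} = resCount Ψ {1, 2, 3} + resCount Ψ {1, 2, 4} ∧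
      resCount Ψ {1, 3, 5} + resCount Ψ {3, 5, 6} = resCount Ψ {2, 4, 6} + resCount Ψ {1, 2, 4} ∧
        resCount Ψ {2, 3, 6} + resCount Ψ {3, 5, 6} = resCount Ψ {1, 4, 5} + resCount Ψ {1, 2, 4} :=
  colsum_relations (fun k => resCount Ψ (res8 k))
    fun _ hc _ hc' => by rw [sum_resCount_res8_eq Ψ hsum hc, sum_resCount_res8_eq Ψ hsum hc']

/-- Under constant sums and `#Q = #Q̄`, every residue set has the same multiplicity as its negative.
[cite: Deligne1982HodgeCycles, I §5 (c) and Lemma 5.2 (pp. 38–40)] -/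
theorem resCount_res8_conj8_eq (Ψ : Fin (2 * m) → CMType L)
    (hsum : ∀ t : L →+* ℂ, {j : Fin (2 * m) | t ∈ (Ψ j).1}.ncard = m)
    (he : resCount Ψ {1, 2, 4} = resCount Ψ {3, 5, 6}) (k : Fin 8) :
    resCount Ψ (res8 (conj8 k)) = resCount Ψ (res8 k) :=
  (colsum_symmetric_iff (fun k => resCount Ψ (res8 k))
    fun _ hc _ hc' => by rw [sum_resCount_res8_eq Ψ hsum hc, sum_resCount_res8_eq Ψ hsum hc']).2 he k

/-- **MAIN COMBINATORIAL THEOREM.  A constant-sum family of CM types of `ℚ(ζ₇)` is a union of conjugate pairs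
(`d(S) = d(S̄)` for every set `S` of embeddings) iff its two `ℚ(√-7)`-induced types occur equally often:
`resCount Ψ {1,2,4} = resCount Ψ {3,5,6}`.**  (⇒ needs no constant sums: `d(Q) = d(Q̄)` is one of the equalities, read
on residue sets; ⇐: by `resCount_res8_conj8_eq` every attained type has the multiplicity of its conjugate.)
[cite: Deligne1982HodgeCycles, I §5 (c) and Lemma 5.2 (pp. 38–40)] [cite: Shimura1998, §8.2 Prop. 26] -/
theorem typeCount_symmetric_iff (Ψ : Fin (2 * m) → CMType L)
    (hsum : ∀ t : L →+* ℂ, {j : Fin (2 * m) | t ∈ (Ψ j).1}.ncard = m) :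
    (∀ S, typeCount Ψ S = typeCount Ψ Sᶜ) ↔ resCount Ψ {1, 2, 4} = resCount Ψ {3, 5, 6} := by
  have n6 : (units7.filter fun c => -c ∈ ({1, 2, 4} : Finset (ZMod 7))) = {3, 5, 6} := by decide
  have n7 : (units7.filter fun c => -c ∈ ({3, 5, 6} : Finset (ZMod 7))) = {1, 2, 4} := by decide
  constructor
  · intro h
    by_cases h6 : ∃ j₀, resSet L (Ψ j₀) = {1, 2, 4}
    · obtain ⟨j₀, hj₀⟩ := h6
      have h' := h (Ψ j₀).1
      rwa [typeCount_self_eq_resCount, typeCount_compl_eq_resCount, hj₀, n6] at h'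
    by_cases h7 : ∃ j₀, resSet L (Ψ j₀) = {3, 5, 6}
    · obtain ⟨j₀, hj₀⟩ := h7
      have h' := h (Ψ j₀).1
      rw [typeCount_self_eq_resCount, typeCount_compl_eq_resCount, hj₀, n7] at h'
      exact h'.symm
    · push Not at h6 h7
      rw [resCount_eq_zero_of_forall_ne Ψ h6, resCount_eq_zero_of_forall_ne Ψ h7]
  · intro he S
    have hk : ∀ j₀, typeCount Ψ (Ψ j₀).1 = typeCount Ψ ((Ψ j₀).1)ᶜ := by
      intro j₀
      obtain ⟨k, hk⟩ := exists_res8_eq_resSet (L := L) (Ψ j₀)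
      rw [typeCount_self_eq_resCount, typeCount_compl_eq_resCount, ← hk, ← res8_conj8,
        resCount_res8_conj8_eq Ψ hsum he]
    by_cases h1 : ∃ j₀, (Ψ j₀).1 = S
    · obtain ⟨j₀, rfl⟩ := h1
      exact hk j₀
    by_cases h2 : ∃ j₀, (Ψ j₀).1 = Sᶜ
    · obtain ⟨j₀, hj₀⟩ := h2
      have hS : S = ((Ψ j₀).1)ᶜ := by rw [hj₀, compl_compl]
      rw [hS, compl_compl]
      exact (hk j₀).symm
    · push Not at h1 h2
      rw [typeCount_eq_zero_of_forall_ne Ψ h1, typeCount_eq_zero_of_forall_ne Ψ h2]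

end Family

end Summit.HodgeConjecture.CorCM.Zeta7WeilFamily

end
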